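import Mathlib
import Literature.Analysis.FluidPDE.ClassicalSolution
import Literature.Analysis.FluidPDE.LerayHopf
import Literature.Analysis.FluidPDE.SereginSverakPressureLocalTypeI
import Summits.NavierStokesRegularity.NavierStokesRegularity.Theses.L3TimeExponentPincer
import Summits.NavierStokesRegularity.NavierStokesRegularity.Theorems.L3TimeExponentPincerEffNode
import Summits.NavierStokesRegularity.NavierStokesRegularity.Theorems.L3TimeExponentPincerPaceDichotomy
import HarnessLib.Audit
import HarnessLib

/-!
# Morrey-Type-I frame solutions are Seregin-centred Type I at EVERY point of the final slice, uniformly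
# — crux `EffSatBlowup`, line `pace`, stub 2's class (route `L3TimeExponentPincer`, item
# `stmt-NavierStokesRegularity-19139`)

Support file (seat ns-pincer-19139-p1, lead of line `pace`; `--supports stmt-NavierStokesRegularity-19139
--as helper`).

Stub 2 of line `pace` (`stub_morreyTypeI_slow`, OPEN) lives on the class `MorreyTypeINear u T` of the crux's
frame: `∫_{B(x₀,r)} |u(t)|² ≤ M r` for all centres `x₀`, all radii `0 < r < r₁` and all times `T - r² < t < T`
(Barker–Prange 2020 (1.7) in energy spelling; only TOP-at-`T` windows).  The line card (nsreg-p2 ROUND-8) lists as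
stub 2's «tools that bite» Seregin's critical-Morrey estimates for suitable weak solutions — «bounded scaled energy
on cylinders ⇒ bounded scaled `L³`/pressure/dissipation on the same cylinders» (G. Seregin, Zap. Nauchn. Sem. POMI
336 (2006) = J. Math. Sci. 143 (2007), Lemma 2.1 (c); tree: `Seregin2020.scaledEnergies_bounded_of_cknAEss_le_unif`,
the CENTRED estimate with a constant depending only on the bound and on the background quantities).  This file turns
that tool on, in the kernel, for the EXACT frame of the crux:

* §1 `lintegral_ball_sq_le_of_morreyTypeINear` — the pace-line predicate in the viscous window `T - r²/ν < t < T`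
  (radius inflation `r ↦ r · max(1, 1/√ν)`).
* §2 `exists_zoom_sereginBounds_of_morreyTypeINear` — **MAIN.**  For a classical solution on `[0,T)` which is
  Leray–Hopf on `[0,T)` and of the Morrey-Type-I class, there are ONE scale `R > 0` (`R²/ν ≤ T`) and ONE constant
  `K` such that for EVERY centre `x₀` the unit-viscosity parabolic zoom about the top point `(T, x₀)`,
  `v = (R/ν) u(T + (R²/ν)s, x₀ + R y)`, pressure `(R/ν)² q ∘ Φ` (`q` = Tao's gauge of the classical pressure = the
  normalised pressure), classical gradient `(R²/ν) ∇u ∘ Φ`, satisfies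
  `A(r) + E(r) + C(r) + D(r) ≤ K` at the centre `0 = Φ⁻¹(T, x₀)` for all `0 < r ≤ 1/2`
  (`A = cknAEss`, `E = cknE`, `C = cknC`, `D = cknD`, the Caffarelli–Kohn–Nirenberg / Seregin scaled quantities).
  In words: **every point of the final slice of a Morrey-Type-I frame solution is a Type-I point in Seregin's
  centred sense (`g`/`G` bounded), with a constant uniform over the slice.**  Proof = the rescaling block of the
  tree's `SereginSverak2002.exists_zoom_typeIBound_lt_top` (suitability of the gauged classical solution on the
  open strip `isSuitableWeakSolutionOn_gauge_of_classical`, covariance `IsSuitableWeakSolutionOn.stRescale`,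
  classical gradient as weak gradient) + uniform background bounds from the GLOBAL quantities
  `∫∫_{(0,T)×ℝ³} |∇u|² < ∞` (`lintegral_slab_frobeniusNormSq_fderiv_lt_top'`) and `∫∫ |q|^{3/2} < ∞`
  (`lintegral_slab_gauged_pressure_lt_top`) + `A ≤ M̃` on the centred cylinders from §1 + Seregin's centred
  estimate (`_unif` form, constant chosen BEFORE the centre).
* The consequences in the frame's own currency — local time-averaged `L³`-Type-I pace
  `∫_{T-ρ²/ν}^{T} ∫_{B(x₀,ρ)} |u|³ ≤ K ρ²` and local Type-I dissipation `∫_{T-ρ²/ν}^{T} ∫_{B(x₀,ρ)} |∇u|² ≤ K ρ`,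
  uniformly in `x₀`, and their restatements on stub 2's class — are in the companion file
  `L3TimeExponentPincerMorreyTypeILocalPace.lean`.

Placement for the line (honest): stub 2 asks for `‖u(t)‖³_{L³(ℝ³)} ≤ A/√(T-t)` at EVERY late time; the centred
bounds give the same exponent only averaged over each top window and ball by ball (time intermittency inside a top
window and the spatial multiplicity of concentration balls remain).  No blow-up hypothesis is used: the bounds hold
for every Morrey-Type-I frame solution, singular at `T` or not.

WHAT THIS IS NOT: not a claim about Navier–Stokes regularity or blow-up; printed estimates (Seregin 2006/2007,
Caffarelli–Kohn–Nirenberg scaled quantities) assembled in the route's frame, kernel-checked, landed `--supports`;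
the crux `EffSatBlowup` and stubs 2–3 of line `pace` stay open.

References: G. Seregin, J. Math. Sci. 143 (2007) = arXiv:math/0607537, Lemma 2.1 (c) [Seregin2006]; G. Seregin,
Zap. Nauchn. Sem. POMI 336 (2006) 199–210; T. Barker, C. Prange, ARMA 236 (2020) = arXiv:1812.09115, (1.7)
[BarkerPrange2020]; L. Caffarelli, R. Kohn, L. Nirenberg, CPAM 35 (1982), §2 [CaffarelliKohnNirenberg1982];
D. Albritton, T. Barker, J. Math. Fluid Mech. 21 (2019), Lemma 2.6 [AlbrittonBarker2019].
-/

noncomputable section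

open MeasureTheory Set Function Filter Metric Topology TopologicalSpace
open scoped ENNReal NNReal Topology
open Literature.Analysis.FluidPDE
open Literature.Analysis.FluidPDE.SereginSverak2002
open Summit.NavierStokesRegularity.NavierStokesRegularity.Theorems.L3TimeExponentPincerEffNode
open Summit.NavierStokesRegularity.NavierStokesRegularity.Theorems.L3TimeExponentPincerPaceDichotomy

namespace Summit.NavierStokesRegularity.NavierStokesRegularity.Theorems.L3TimeExponentPincerMorreyTypeICentred

variable {ν T : ℝ} {u : ℝ → EuclideanSpace ℝ (Fin 3) → EuclideanSpace ℝ (Fin 3)}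
  {p : ℝ → EuclideanSpace ℝ (Fin 3) → ℝ}

/-! ## §1  The pace-line Morrey predicate in the viscous time window -/

/-- **`MorreyTypeINear` in the viscous window.**  If `∫_{B(x₀,r)}|u(t)|² ≤ M r` for all centres, all `r < r₁` and
all `T - r² < t < T`, then for some `M₁, r₂ > 0`: `∫_{B(x₀,r)}|u(t)|² ≤ M₁ r` for all centres, all `0 < r ≤ r₂` and
all `T - r²/ν < t < T` (inflate the radius to `r·max(1, 1/√ν)`, whose window `r² max(1, 1/ν) ≥ r²/ν` contains the
viscous one; `M₁ = M·max(1, 1/√ν)`, `r₂ = r₁ / (2 max(1, 1/√ν))`). [cite: BarkerPrange2020, (1.7) and the remark p. 5] -/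
theorem lintegral_ball_sq_le_of_morreyTypeINear (hν : 0 < ν) (hMor : MorreyTypeINear u T) :
    ∃ M₁ : ℝ, 0 < M₁ ∧ ∃ r₂ : ℝ, 0 < r₂ ∧ ∀ (x₀ : EuclideanSpace ℝ (Fin 3)) (r : ℝ), 0 < r → r ≤ r₂ →
      ∀ t : ℝ, T - r ^ 2 / ν < t → t < T →
        ∫⁻ x in ball x₀ r, ‖u t x‖ₑ ^ 2 ≤ ENNReal.ofReal (M₁ * r) := by
  obtain ⟨M, hM, r₁, hr₁, hMr⟩ := hMor
  set κ : ℝ := max 1 (Real.sqrt ν)⁻¹ with hκ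
  have hκ1 : 1 ≤ κ := le_max_left _ _
  have hκpos : 0 < κ := lt_of_lt_of_le one_pos hκ1
  have hsν : 0 < Real.sqrt ν := Real.sqrt_pos.2 hν
  have hκν : ν⁻¹ ≤ κ ^ 2 := by
    have h1 : (Real.sqrt ν)⁻¹ ≤ κ := le_max_right _ _
    have h2 : ((Real.sqrt ν)⁻¹) ^ 2 ≤ κ ^ 2 := pow_le_pow_left₀ (inv_nonneg.2 hsν.le) h1 2
    rw [inv_pow, Real.sq_sqrt hν.le] at h2
    exact h2
  refine ⟨M * κ, mul_pos hM hκpos, r₁ / (2 * κ), by positivity, fun x₀ r hr hrr t ht1 ht2 => ?_⟩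
  -- the inflated radius `ρ = κ r < r₁`, whose window contains the viscous one
  set ρ : ℝ := κ * r with hρ
  have hρpos : 0 < ρ := mul_pos hκpos hr
  have hρr₁ : ρ < r₁ := by
    have h1 : κ * r ≤ κ * (r₁ / (2 * κ)) := mul_le_mul_of_nonneg_left hrr hκpos.le
    have h2 : κ * (r₁ / (2 * κ)) = r₁ / 2 := by field_simp
    rw [hρ]; linarith
  have hrρ : r ≤ ρ := by rw [hρ]; exact le_mul_of_one_le_left hr.le hκ1
  have hwin : T - ρ ^ 2 < t := by
    have h1 : r ^ 2 / ν ≤ ρ ^ 2 := by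
      rw [hρ, mul_pow, div_eq_mul_inv, mul_comm]
      exact mul_le_mul_of_nonneg_right hκν (sq_nonneg r)
    linarith
  calc ∫⁻ x in ball x₀ r, ‖u t x‖ₑ ^ 2 ≤ ∫⁻ x in ball x₀ ρ, ‖u t x‖ₑ ^ 2 :=
        lintegral_mono_set (ball_subset_ball hrρ)
    _ ≤ ENNReal.ofReal (M * ρ) := hMr x₀ ρ hρpos hρr₁ t hwin ht2
    _ = ENNReal.ofReal (M * κ * r) := by rw [hρ, mul_assoc]

/-! ## §2  Seregin's centred Type-I bounds at every point of the final slice, uniformly -/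

/-- Elementary: pulling a factor out of `a⁻¹ (c I) ≤ K` in `ℝ≥0∞`. [folklore] -/
theorem le_of_inv_mul_mul_le {a c I K : ℝ≥0∞} (ha0 : a ≠ 0) (hat : a ≠ ∞) (hc0 : c ≠ 0) (hct : c ≠ ∞)
    (h : a⁻¹ * (c * I) ≤ K) : I ≤ c⁻¹ * K * a := by
  calc I = c⁻¹ * (a * (a⁻¹ * (c * I))) := by
        rw [← mul_assoc a, ENNReal.mul_inv_cancel ha0 hat, one_mul, ← mul_assoc,
          ENNReal.inv_mul_cancel hc0 hct, one_mul]
    _ ≤ c⁻¹ * (a * K) := by gcongr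
    _ = c⁻¹ * K * a := by ring

/-- `∫⁻ ‖f‖ₑ ^ 3` with the natural-number power is the one with the real power. [folklore] -/
theorem setLIntegral_enorm_pow_three_eq_rpow {X : Type*} [MeasurableSpace X] (μ : Measure X)
    {F : Type*} [NormedAddCommGroup F] (f : X → F) (S : Set X) :
    ∫⁻ z in S, ‖f z‖ₑ ^ (3 : ℕ) ∂μ = ∫⁻ z in S, ‖f z‖ₑ ^ (3 : ℝ) ∂μ := by
  refine lintegral_congr fun z => ?_
  rw [← ENNReal.rpow_natCast]
  norm_num

/-- **MAIN — Morrey-Type-I frame solutions are Seregin-centred Type I at every point of the final slice, with a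
uniform constant.**  Let `(u, p)` be a classical solution on `[0,T)` with viscosity `ν > 0`, Leray–Hopf on `[0,T)`,
of the pace-line class `MorreyTypeINear u T`.  Then there are a scale `R > 0` with `R²/ν ≤ T` and a constant `K`
such that for EVERY `x₀`, with `Φ(s,y) = (T + (R²/ν)s, x₀ + Ry)`, `α = R/ν`, the unit-viscosity zoom
`v = α u ∘ Φ`, the zoomed gauged pressure `α² q ∘ Φ` (`q(t,x) = p(t,x) - (p(t,0) - p̃[u(t)](0))`) and the zoomed
classical gradient `(αR) ∇u ∘ Φ` satisfy, at the centre `0` and every radius `0 < r ≤ 1/2`,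
`A(r) + E(r) + C(r) + D(r) ≤ K` (Seregin 2006, Lemma 2.1 (c), applied at the top point `(T,x₀) ↦ 0` of the zoom:
its hypothesis `sup_{r ≤ 1} A(r) < ∞` is the Morrey-Type-I bound transported along `Φ`, its background quantities
`E(1)`, `D(1)` are bounded by the global dissipation and the global `L^{3/2}` norm of the gauged pressure, whence
the uniformity in `x₀`). [cite: Seregin2006, Lemma 2.1 (c) (arXiv:math/0607537 §2)] -/
theorem exists_zoom_sereginBounds_of_morreyTypeINear (hν : 0 < ν) (hT : 0 < T)
    (hsol : IsClassicalNSSolutionOn (Ico 0 T) ν 0 u p) (hLH : IsLerayHopfOn T ν 0 (u 0) u)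
    (hMor : MorreyTypeINear u T) :
    ∃ R : ℝ, 0 < R ∧ R ^ 2 / ν ≤ T ∧ ∃ K : ℝ≥0, ∀ x₀ : EuclideanSpace ℝ (Fin 3), ∀ r ∈ Ioc (0 : ℝ) (1 / 2),
      cknAEss r 0 ((R / ν) • stPull (R ^ 2 / ν) R T x₀ u) +
        cknE r 0 ((R / ν * R) • stPull (R ^ 2 / ν) R T x₀ fun t x => fderiv ℝ (u t) x) +
        cknC r 0 ((R / ν) • stPull (R ^ 2 / ν) R T x₀ u) +
        cknD r 0 ((R / ν) ^ 2 • stPull (R ^ 2 / ν) R T x₀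
          fun t x => p t x - (p t 0 - normalisedPressure (u t) 0)) ≤ K := by
  -- §1: the Morrey bound in the viscous window
  obtain ⟨M₁, hM₁, r₂, hr₂, hA1⟩ := lintegral_ball_sq_le_of_morreyTypeINear hν hMor
  -- the scale: `R ≤ r₂`, `R²/ν ≤ T`
  set R : ℝ := min r₂ (Real.sqrt (ν * T)) with hR
  have hRpos : 0 < R := lt_min hr₂ (Real.sqrt_pos.2 (by positivity))
  have hRr₂ : R ≤ r₂ := min_le_left _ _
  set α : ℝ := R / ν with hα
  set β : ℝ := R ^ 2 / ν with hβdef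
  have hαpos : 0 < α := by positivity
  have hβpos : 0 < β := by positivity
  have hβeq : β = α * R := by rw [hβdef, hα]; field_simp
  have hβT : β ≤ T := by
    have h1 : R ≤ Real.sqrt (ν * T) := min_le_right _ _
    have h2 : R ^ 2 ≤ ν * T := by
      have := pow_le_pow_left₀ hRpos.le h1 2
      rwa [Real.sq_sqrt (by positivity)] at this
    rw [hβdef, div_le_iff₀ hν]; linarith
  -- the gauged pressure and the global background quantities
  set q : ℝ → EuclideanSpace ℝ (Fin 3) → ℝ := fun t x => p t x - (p t 0 - normalisedPressure (u t) 0) with hq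
  set IG : ℝ≥0∞ := ∫⁻ z in Ioo 0 T ×ˢ (univ : Set (EuclideanSpace ℝ (Fin 3))),
    ENNReal.ofReal (frobeniusNormSq (fderiv ℝ (u z.1) z.2)) with hIG
  have hIGtop : IG < ∞ := lintegral_slab_frobeniusNormSq_fderiv_lt_top' hsol hLH
  set IP : ℝ≥0∞ := ∫⁻ z in Ioo 0 T ×ˢ (univ : Set (EuclideanSpace ℝ (Fin 3))),
    ‖q z.1 z.2‖ₑ ^ (3 / 2 : ℝ) with hIP
  have hIPtop : IP < ∞ := lintegral_slab_gauged_pressure_lt_top hν hT hsol hLH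
  -- the three uniform constants
  set eA : ℝ≥0∞ := ‖α‖ₑ ^ 2 * (ENNReal.ofReal (R ^ 3)⁻¹ * ENNReal.ofReal (M₁ * R)) with heA
  have heAtop : eA ≠ ∞ := ENNReal.mul_ne_top (by simp)
    (ENNReal.mul_ne_top ENNReal.ofReal_ne_top ENNReal.ofReal_ne_top)
  set eE : ℝ≥0∞ := (ENNReal.ofReal 1)⁻¹ *
    (ENNReal.ofReal ((α * R) ^ 2) * ENNReal.ofReal (β * R ^ 3)⁻¹ * IG) with heE
  have heEtop : eE ≠ ∞ := ENNReal.mul_ne_top (by simp)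
    (ENNReal.mul_ne_top (ENNReal.mul_ne_top ENNReal.ofReal_ne_top ENNReal.ofReal_ne_top) hIGtop.ne)
  set eD : ℝ≥0∞ := (ENNReal.ofReal 1 ^ 2)⁻¹ *
    (‖α ^ 2‖ₑ ^ (3 / 2 : ℝ) * ENNReal.ofReal (β * R ^ 3)⁻¹ * IP) with heD
  have heDtop : eD ≠ ∞ := ENNReal.mul_ne_top (by simp)
    (ENNReal.mul_ne_top (ENNReal.mul_ne_top
      (ENNReal.rpow_ne_top_of_nonneg (by norm_num) enorm_ne_top) ENNReal.ofReal_ne_top) hIPtop.ne)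
  -- Seregin's centred estimate with these constants (the constant `K` is fixed BEFORE the centre)
  obtain ⟨K, hK⟩ := Seregin2020.scaledEnergies_bounded_of_cknAEss_le_unif eA.toNNReal eE.toNNReal eD.toNNReal
  refine ⟨R, hRpos, hβT, K, fun x₀ r hr => ?_⟩
  -- ### the zoom about `(T, x₀)`
  set PO : Opens (ℝ × EuclideanSpace ℝ (Fin 3)) :=
    ⟨Ioo (T - β) T ×ˢ ball x₀ R, isOpen_Ioo.prod isOpen_ball⟩ with hPO
  have hPOslab : (PO : Set (ℝ × EuclideanSpace ℝ (Fin 3))) ⊆ Ioo 0 T ×ˢ (univ : Set (EuclideanSpace ℝ (Fin 3))) := by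
    rintro ⟨t, x⟩ ⟨ht, -⟩
    exact ⟨⟨by linarith [ht.1], ht.2⟩, mem_univ _⟩
  have hpre1 : stPreimage β R T x₀ PO = parabolicCylinderOpens 1 (0 : ℝ × EuclideanSpace ℝ (Fin 3)) := by
    apply Opens.ext
    rw [coe_stPreimage]
    have h := stAffine_preimage_cylinder_eq_parabolicCylinder hν hRpos T x₀ R
    rw [div_self hRpos.ne'] at h
    exact h
  -- suitability of the zoom on `Q(0,1)` with unit viscosity
  have hsuit1 : IsSuitableWeakSolutionOn (parabolicCylinderOpens 1 (0 : ℝ × EuclideanSpace ℝ (Fin 3))) 1 0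
      (α • stPull β R T x₀ u) (α ^ 2 • stPull β R T x₀ q) := by
    have h0 := (isSuitableWeakSolutionOn_gauge_of_classical hν hT hsol hLH PO hPOslab).stRescale
      hαpos hRpos hβeq T x₀
    have hvisc : α * ν / R = 1 := by rw [hα, div_mul_cancel₀ R hν.ne', div_self hRpos.ne']
    have hforce : ((α ^ 2 * R) • stPull β R T x₀ (0 : ℝ → EuclideanSpace ℝ (Fin 3) → EuclideanSpace ℝ (Fin 3))) = 0 := by
      funext s y; simp [stPull]
    rw [hvisc, hforce, hpre1] at h0
    exact h0
  -- the zoomed classical gradient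
  have hGu : HasWeakSpatialGradientOn PO u fun t x => fderiv ℝ (u t) x :=
    hasWeakSpatialGradientOn_of_contDiffOn isOpen_Ioo hPOslab
      ((classical_Ioo hsol).smooth_velocity.of_le (by norm_cast))
  have hGv : HasWeakSpatialGradientOn (parabolicCylinderOpens 1 (0 : ℝ × EuclideanSpace ℝ (Fin 3)))
      (α • stPull β R T x₀ u) ((α * R) • stPull β R T x₀ fun t x => fderiv ℝ (u t) x) := by
    rw [← hpre1]
    exact hGu.stRescale α hβpos hRpos T x₀
  -- the unit cylinder as a preimage
  have hpre : parabolicCylinder 1 (0 : ℝ × EuclideanSpace ℝ (Fin 3)) =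
      stAffine β R T x₀ ⁻¹' (Ioo (T - (R * 1) ^ 2 / ν) T ×ˢ ball x₀ (R * 1)) := by
    rw [hβdef, stAffine_preimage_cylinder_eq_parabolicCylinder hν hRpos T x₀ (R * 1),
      mul_div_cancel_left₀ (1 : ℝ) hRpos.ne']
    rfl
  have hcylslab : Ioo (T - (R * 1) ^ 2 / ν) T ×ˢ ball x₀ (R * 1) ⊆
      Ioo 0 T ×ˢ (univ : Set (EuclideanSpace ℝ (Fin 3))) := by
    rw [mul_one]
    rintro ⟨t, x⟩ ⟨ht, -⟩
    refine ⟨⟨?_, ht.2⟩, mem_univ _⟩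
    have : R ^ 2 / ν = β := rfl
    linarith [ht.1]
  -- ### (E) the background dissipation at the unit scale
  have hE1 : cknE 1 (0 : ℝ × EuclideanSpace ℝ (Fin 3))
      ((α * R) • stPull β R T x₀ fun t x => fderiv ℝ (u t) x) ≤ (eE.toNNReal : ℝ≥0∞) := by
    rw [ENNReal.coe_toNNReal heEtop, heE]
    unfold cknE
    rw [hpre, setLIntegral_frobeniusNormSq_stRescale hβpos hRpos T x₀ (α * R), finrank_euclideanSpace_fin]
    gcongr
    exact lintegral_mono_set hcylslab
  -- ### (D) the background pressure at the unit scale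
  have hD1 : cknD 1 (0 : ℝ × EuclideanSpace ℝ (Fin 3)) (α ^ 2 • stPull β R T x₀ q) ≤ (eD.toNNReal : ℝ≥0∞) := by
    rw [ENNReal.coe_toNNReal heDtop, heD]
    unfold cknD
    rw [hpre, setLIntegral_enorm_rpow_stRescale hβpos hRpos T x₀ (α ^ 2) q _ (by norm_num),
      finrank_euclideanSpace_fin]
    gcongr
    exact lintegral_mono_set hcylslab
  -- ### (A) the Morrey bound on the centred cylinders `Q(0, r')`, `0 < r' ≤ 1`
  have hA : ∀ r' ∈ Ioc (0 : ℝ) 1, cknAEss r' (0 : ℝ × EuclideanSpace ℝ (Fin 3)) (α • stPull β R T x₀ u) ≤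
      (eA.toNNReal : ℝ≥0∞) := by
    intro r' hr'
    rw [ENNReal.coe_toNNReal heAtop]
    have hr'pos : 0 < r' := hr'.1
    have hRr' : R * r' ≤ r₂ := by nlinarith [hr'.2, hRr₂]
    -- the physical slices: `∫_{B(x₀, R r')} |u(t)|² ≤ M₁ R r'` for `T - (R r')²/ν < t < T`
    have hphys : ∀ᵐ t ∂(volume.restrict (Ioo (T + β * ((0 : ℝ) - r' ^ 2)) (T + β * 0))),
        ∫⁻ x in ball (x₀ + R • (0 : EuclideanSpace ℝ (Fin 3))) (R * r'), ‖u t x‖ₑ ^ 2 ≤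
          ENNReal.ofReal (M₁ * (R * r')) := by
      refine (ae_restrict_mem measurableSet_Ioo).mono fun t ht => ?_
      rw [smul_zero, add_zero]
      refine hA1 x₀ (R * r') (by positivity) hRr' t ?_ ?_
      · have e : T + β * (0 - r' ^ 2) = T - (R * r') ^ 2 / ν := by rw [hβdef]; ring
        rw [← e]; exact ht.1
      · simpa using ht.2
    have h2 := ae_sliced_setLIntegral_ball_stRescale hβpos hRpos T x₀ (x₀ + R • (0 : EuclideanSpace ℝ (Fin 3)))
      (R * r') (0 - r' ^ 2) 0 (fun t x => ‖u t x‖ₑ ^ 2) hphys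
    rw [finrank_euclideanSpace_fin, add_sub_cancel_left, smul_smul, inv_mul_cancel₀ hRpos.ne',
      one_smul, mul_div_cancel_left₀ r' hRpos.ne'] at h2
    unfold cknAEss
    refine essSup_le_of_ae_le _ ?_
    have hset : Ioo ((0 : ℝ × EuclideanSpace ℝ (Fin 3)).1 - r' ^ 2) (0 : ℝ × EuclideanSpace ℝ (Fin 3)).1 =
        Ioo ((0 : ℝ) - r' ^ 2) 0 := by simp
    rw [hset]
    filter_upwards [h2] with s hs
    have e : ∀ y : EuclideanSpace ℝ (Fin 3), ‖(α • stPull β R T x₀ u) s y‖ₑ ^ 2 =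
        ‖α‖ₑ ^ 2 * ‖u (T + β * s) (x₀ + R • y)‖ₑ ^ 2 := by
      intro y
      rw [smul_stPull_apply, enorm_smul, mul_pow]
    simp only [e, Prod.snd_zero]
    rw [lintegral_const_mul' _ _ (by simp)]
    have hr0 : ENNReal.ofReal r' ≠ 0 := (ENNReal.ofReal_pos.2 hr'pos).ne'
    calc (ENNReal.ofReal r')⁻¹ * (‖α‖ₑ ^ 2 *
          ∫⁻ y in ball (0 : EuclideanSpace ℝ (Fin 3)) r', ‖u (T + β * s) (x₀ + R • y)‖ₑ ^ 2)
        ≤ (ENNReal.ofReal r')⁻¹ * (‖α‖ₑ ^ 2 *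
            (ENNReal.ofReal (R ^ 3)⁻¹ * ENNReal.ofReal (M₁ * (R * r')))) :=
          mul_le_mul' le_rfl (mul_le_mul' le_rfl hs)
      _ = eA := by
          rw [heA, show M₁ * (R * r') = (M₁ * R) * r' by ring,
            ENNReal.ofReal_mul (by positivity : (0:ℝ) ≤ M₁ * R)]
          rw [show (ENNReal.ofReal r')⁻¹ * (‖α‖ₑ ^ 2 * (ENNReal.ofReal (R ^ 3)⁻¹ *
              (ENNReal.ofReal (M₁ * R) * ENNReal.ofReal r'))) =
              ‖α‖ₑ ^ 2 * (ENNReal.ofReal (R ^ 3)⁻¹ * ENNReal.ofReal (M₁ * R)) *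
                ((ENNReal.ofReal r')⁻¹ * ENNReal.ofReal r') by ring,
            ENNReal.inv_mul_cancel hr0 ENNReal.ofReal_ne_top, mul_one]
  -- ### Seregin's estimate at the centre `0`, base radius `1`
  have hsub : parabolicCylinder 1 (0 : ℝ × EuclideanSpace ℝ (Fin 3)) ⊆
      ((parabolicCylinderOpens 1 (0 : ℝ × EuclideanSpace ℝ (Fin 3)) : Opens (ℝ × EuclideanSpace ℝ (Fin 3))) :
        Set (ℝ × EuclideanSpace ℝ (Fin 3))) := by
    rw [coe_parabolicCylinderOpens]
  have hmain := hK _ _ _ _ hsuit1 hGv 0 1 one_pos hsub hE1 hD1 hA r ⟨hr.1, hr.2⟩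
  have hα2 : (R / ν) ^ 2 = α ^ 2 := by rw [hα]
  rw [hα2]
  exact hmain

end Summit.NavierStokesRegularity.NavierStokesRegularity.Theorems.L3TimeExponentPincerMorreyTypeICentred

end
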